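import Summits.AtomisticToContinuum.HydrodynamicLimit.Theorems.CollisionIsometryCLTMacroClosureEngineGoodEvent
import Summits.AtomisticToContinuum.HydrodynamicLimit.Theorems.CollisionIsometryCLTMacroClosureEngineCore
import Summits.AtomisticToContinuum.HydrodynamicLimit.Theorems.CollisionIsometryCLTMacroClosureEngineInitial
import Summits.AtomisticToContinuum.HydrodynamicLimit.Theorems.CollisionIsometryCLTMacroClosureEngineReadout
import Summits.AtomisticToContinuum.HydrodynamicLimit.Theorems.CollisionIsometryCLTMacroClosureEngineEntropyLedger
import Summits.AtomisticToContinuum.HydrodynamicLimit.Theorems.CollisionIsometryCLTMacroClosureEngineAeDistinct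
import Summits.AtomisticToContinuum.HydrodynamicLimit.Theorems.CollisionIsometryCLTMacroClosureEngineIncrementBound
import HarnessLib

/-!
# The pointwise barycentric engine `stub_engine_pointwise` (line `IdeatorTwoGen1Sketch`, crux `MacroClosure`,
stmt-AtomisticToContinuum-14870): assembly

Proof file (`--supports stmt-AtomisticToContinuum-14870`) of the line lead (continuation c1) for the registered stub
`Barycentric.stub_engine_pointwise` of the skeleton `Cruxes/MacroClosure/Lines/IdeatorTwoGen1Sketch.lean`, assembled
from the landed engine pieces: the good event with its diagonal tolerance (`engine_goodEvent`), refined by the a.e.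
all-time distinctness of velocities (`engine_aeDistinct`); the entropy ledger (`engine_entropyLedger`); the initial
term (`engine_initial`); the increment bound (`engine_incrementBound`: tested balance laws + relative-flux race + hot
cells + Tonelli); the abstract Gronwall (`engine_core`); the coercive readout (`engine_readout`).
-/

noncomputable section

open MeasureTheory Filter Set Topology InformationTheory
open scoped ENNReal ContDiff

namespace Summit.AtomisticToContinuum.HydrodynamicLimit.Theorems.MacroClosureLine

open Literature.MathematicalPhysics.KineticTheory Literature.Analysis.FluidPDE
open Literature.Analysis.FunctionSpaces
open Summit.AtomisticToContinuum.HydrodynamicLimit.Theses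

namespace Barycentric

/-! ## Assembly -/

/-- **The pointwise barycentric engine** (registered stub `stub_engine_pointwise` of the skeleton
`Cruxes/MacroClosure/Lines/IdeatorTwoGen1Sketch.lean`): at ONE `σ`, ONE classical solution in the chamber, ONE
flow family, ONE admissible kernel family and ONE time `0 < t < T`, the instantiated conclusions of APS (i), APS (ii),
FMR, CTL (at the tests `(θ⁻¹u, −θ⁻¹)`) and Clausius in mean on every good band event give the law of large numbers
of the empirical fields at time `t`. Assembly: good event + diagonal tolerance (`engine_goodEvent`), refined by the
a.e. all-time distinctness of velocities (`engine_aeDistinct`); entropy ledger (`engine_entropyLedger`); initial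
term (`engine_initial`); increment bound (`engine_incrementBound`); abstract Gronwall (`engine_core`); coercive
readout (`engine_readout`). [cite: Dafermos2005, Thm 5.2.1] [cite: Yau1991, §2] -/
theorem stub_engine_pointwise : ∀ (σ : ℝ), 0 < σ → σ < 2⁻¹ → StiffCollisionalRelaxation.HsFreeEnergyConvex →
    ∀ (a₀ θ₀ : T3 → ℝ) (u₀ : T3 → V3), Continuous a₀ → Continuous θ₀ → Continuous u₀ →
    (∀ x, 0 < a₀ x) → (∀ x, 0 < θ₀ x) →
    ∀ (T : ℝ) (ρ θ : ℝ → T3 → ℝ) (u : ℝ → T3 → V3), IsHardSphereEulerSolution σ T ρ u θ →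
    ∀ η₃ : ℝ, ThermoChamber η₃ → (∀ s ∈ Ico 0 T, ∀ x, ρ s x * σ ^ 3 < η₃) →
    ∀ Φ : (N : ℕ) → Flow σ N,
      TendstoHydroFieldsAt (fun N => localGibbsLaw σ a₀ u₀ θ₀ N (Φ N)) Φ ρ u θ 0 →
    ∀ (γ C : ℝ) (φ : ℕ → T3 → ℝ), 0 < γ → γ ≤ 1 / 15 → AdmissibleKernel γ C φ →
    ∀ t : ℝ, 0 < t → t < T →
    (∃ lam Cexp : ℝ, 0 < lam ∧ Tendsto (fun N : ℕ => localGibbsLaw σ a₀ u₀ θ₀ N (Φ N)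
      {z | Cexp < ∫ s in Icc 0 t, ∫ y, Real.exp (lam * ‖y.2‖ ^ 2) ∂(empiricalMeasure ((Φ N).flow s z))})
      atTop (𝓝 0)) →
    (∃ c₁ : ℝ, 0 < c₁ ∧ Tendsto (fun N : ℕ => localGibbsLaw σ a₀ u₀ θ₀ N (Φ N)
      {z | ∃ s ∈ Icc 0 t, ∃ x : T3, bρ (φ N) ((Φ N).flow s z) x < c₁ ∨
        1 < bρ (φ N) ((Φ N).flow s z) x * σ ^ 3}) atTop (𝓝 0)) →
    (∀ δ : ℝ, 0 < δ → Tendsto (fun N : ℕ => localGibbsLaw σ a₀ u₀ θ₀ N (Φ N)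
      {z | δ < ∫ s in Icc 0 t, ∫ x, ((∑ j, ∑ k, bD (φ N) ((Φ N).flow s z) x j k ^ 2) +
        ‖bq (φ N) ((Φ N).flow s z) x‖ ^ 2)}) atTop (𝓝 0)) →
    (∀ δ : ℝ, 0 < δ → Tendsto (fun N : ℕ => localGibbsLaw σ a₀ u₀ θ₀ N (Φ N)
      {z | ∃ τ ∈ Icc 0 t, δ < |ccRes θ u (Φ N) z τ -
        ∫ s in Icc 0 τ, ∫ x, ccClosure σ θ u (φ N) s ((Φ N).flow s z) x|}) atTop (𝓝 0)) →
    (∀ c₁ : ℝ, 0 < c₁ → ∀ G : (N : ℕ) → Set (Config (N + 1) (Fin 3) T3), (∀ N, MeasurableSet (G N)) →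
      (∀ N, G N ⊆ (Φ N).good) →
      (∀ N, ∀ z ∈ G N, ∀ s ∈ Icc 0 t, ∀ x,
          c₁ ≤ bρ (φ N) ((Φ N).flow s z) x ∧ bρ (φ N) ((Φ N).flow s z) x * σ ^ 3 ≤ 1) →
      Tendsto (fun N => localGibbsLaw σ a₀ u₀ θ₀ N (Φ N) (G N)ᶜ) atTop (𝓝 0) →
      ∀ δ : ℝ, 0 < δ → ∀ᶠ N : ℕ in atTop, ∀ s ∈ Icc 0 t,
        Integrable (fun z => (G N).indicator
            (fun z => ∫ x, hsEntropy σ (bU (φ N) ((Φ N).flow s z) x)) z)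
          (localGibbsLaw σ a₀ u₀ θ₀ N (Φ N)) ∧
        ∫ z, (G N).indicator (fun z => ∫ x, hsEntropy σ (bU (φ N) ((Φ N).flow s z) x)) z
            ∂(localGibbsLaw σ a₀ u₀ θ₀ N (Φ N)) ≤
          (∫ x, hsEntropy σ (stateOf (ρ 0 x) (u 0 x) (θ 0 x))) + δ) →
    TendstoHydroFieldsAt (fun N => localGibbsLaw σ a₀ u₀ θ₀ N (Φ N)) Φ ρ u θ t := by
  intro σ hσ hσ2 hH a₀ θ₀ u₀ ha hθ hu ha0 hθ0 T ρ θ u hsol η₃ hT hch Φ h0 γ C φ hγ hγ' hφ t ht htT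
    hA1 hA2 hF hC hCl
  have hσhalf : σ ≤ 1 / 2 := by
    have h := hσ2; norm_num at h ⊢; linarith
  have hT0 : 0 < T := ht.trans htT
  have htI : t ∈ Ico 0 T := ⟨ht.le, htT⟩
  set P : (N : ℕ) → Measure (Config (N + 1) (Fin 3) T3) :=
    fun N => localGibbsLaw σ a₀ u₀ θ₀ N (Φ N) with hP
  haveI hPprob : ∀ N, IsProbabilityMeasure (P N) := fun N =>
    isProbabilityMeasure_localGibbsLaw ha hθ hu ha0 hθ0 hσhalf N (Φ N)
  -- Step A: the good event and the diagonal tolerance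
  obtain ⟨G, δs, lam, Cexp, c₁, hlam, hc₁, hδpos, hδ0, hGm, hGg, hGc, hGz⟩ :=
    engine_goodEvent σ a₀ θ₀ u₀ ha hθ hu ha0 hθ0 hσ hσhalf θ u Φ φ t hA1 hA2 hF hC
  -- WLOG the band is non-empty: `c₁ σ³ ≤ 1`
  have hσ3 : 0 < σ ^ 3 := pow_pos hσ 3
  have hc₁σ : c₁ * σ ^ 3 ≤ 1 := by
    by_contra hcon
    have hGempty : ∀ N, G N = ∅ := by
      intro N
      ext z
      simp only [mem_empty_iff_false, iff_false]
      intro hz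
      obtain ⟨h1, h2⟩ := (hGz N z hz).2.1 0 ⟨le_rfl, ht.le⟩ 0
      exact hcon ((mul_le_mul_of_nonneg_right h1 hσ3.le).trans h2)
    have h1 : Tendsto (fun _ : ℕ => (1 : ℝ≥0∞)) atTop (𝓝 0) := by
      refine hGc.congr fun N => ?_
      rw [hGempty N, compl_empty]; exact measure_univ
    exact absurd (tendsto_nhds_unique h1 tendsto_const_nhds) zero_ne_one
  -- Step A': refine the good events by the a.e. all-time distinctness of velocities
  have hS : ∀ N, ∃ S : Set (Config (N + 1) (Fin 3) T3), MeasurableSet S ∧ P N Sᶜ = 0 ∧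
      ∀ z ∈ S, z ∈ (Φ N).good → ∀ τ ∈ Icc 0 t, ∀ i j : Fin (N + 1), i ≠ j →
        ((Φ N).flow τ z i).2 ≠ ((Φ N).flow τ z j).2 := fun N =>
    engine_aeDistinct σ hσ hσhalf a₀ θ₀ u₀ ha hθ hu ha0 hθ0 N (Φ N) t
  choose S hSm hS0 hSd using hS
  set G' : (N : ℕ) → Set (Config (N + 1) (Fin 3) T3) := fun N => G N ∩ S N with hG'
  have hG'm : ∀ N, MeasurableSet (G' N) := fun N => (hGm N).inter (hSm N)
  have hG'g : ∀ N, G' N ⊆ (Φ N).good := fun N => inter_subset_left.trans (hGg N)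
  have hG'c : Tendsto (fun N => P N (G' N)ᶜ) atTop (𝓝 0) := by
    have hle : ∀ N, P N (G' N)ᶜ ≤ P N (G N)ᶜ + 0 := by
      intro N
      have : (G' N)ᶜ = (G N)ᶜ ∪ (S N)ᶜ := by rw [hG']; exact compl_inter _ _
      rw [this, ← hS0 N]
      exact measure_union_le _ _
    have hlim : Tendsto (fun N => P N (G N)ᶜ + 0) atTop (𝓝 0) := by simpa using hGc
    exact tendsto_of_tendsto_of_tendsto_of_le_of_le tendsto_const_nhds hlim (fun _ => zero_le) hle
  have hG'z : ∀ N, ∀ z ∈ G' N,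
      (∫ s in Icc 0 t, ∫ y, Real.exp (lam * ‖y.2‖ ^ 2) ∂(empiricalMeasure ((Φ N).flow s z)) ≤ Cexp) ∧
      (∀ s ∈ Icc 0 t, ∀ x, c₁ ≤ bρ (φ N) ((Φ N).flow s z) x ∧ bρ (φ N) ((Φ N).flow s z) x * σ ^ 3 ≤ 1) ∧
      (∫ s in Icc 0 t, ∫ x, ((∑ j, ∑ k, bD (φ N) ((Φ N).flow s z) x j k ^ 2) +
        ‖bq (φ N) ((Φ N).flow s z) x‖ ^ 2) ≤ δs N) ∧
      (∀ τ ∈ Icc 0 t, |ccRes θ u (Φ N) z τ -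
        ∫ s in Icc 0 τ, ∫ x, ccClosure σ θ u (φ N) s ((Φ N).flow s z) x| ≤ δs N) :=
    fun N z hz => hGz N z hz.1
  have hG'band : ∀ N, ∀ z ∈ G' N, ∀ s ∈ Icc 0 t, ∀ x,
      c₁ ≤ bρ (φ N) ((Φ N).flow s z) x ∧ bρ (φ N) ((Φ N).flow s z) x * σ ^ 3 ≤ 1 :=
    fun N z hz => (hG'z N z hz).2.1
  have hG'd : ∀ N, ∀ z ∈ G' N, ∀ τ ∈ Icc 0 t, ∀ i j : Fin (N + 1), i ≠ j →
      ((Φ N).flow τ z i).2 ≠ ((Φ N).flow τ z j).2 :=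
    fun N z hz => hSd N z hz.2 (hGg N hz.1)
  -- Step B: the entropy ledger on the refined good events
  have hLed := engine_entropyLedger σ hσ hσhalf hH a₀ θ₀ u₀ ha hθ hu ha0 hθ0 T ρ θ u hsol η₃ hT hch Φ γ C φ
    hγ hγ' hφ t c₁ ht htT hc₁ hc₁σ G' hG'm hG'g hG'band hG'c (hCl c₁ hc₁ G' hG'm hG'g hG'band hG'c)
  -- Step C: the initial term
  have hInit := engine_initial σ hσ hσhalf a₀ θ₀ u₀ ha hθ hu ha0 hθ0 T ρ θ u hsol hT0 η₃ hT hch Φ h0 G'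
    hG'm hG'g hG'c
  -- Step D: the increment bound
  obtain ⟨K, hK, err, herr, hHev, hInc⟩ := engine_incrementBound σ hσ hσ2 hH a₀ θ₀ u₀ ha hθ hu ha0 hθ0
    T ρ θ u hsol η₃ hT hch Φ γ C φ hγ hγ' hφ t ht htT c₁ lam Cexp hc₁ hc₁σ hlam δs hδ0 G' hG'm hG'g hG'z
    hG'd (hLed 1 one_pos)
  -- the two sequences of the abstract Gronwall
  set H : ℕ → ℝ → ℝ := fun N τ => ∫ z, (G' N).indicator
      (fun z => ∫ x, relEnt σ (bU (φ N) ((Φ N).flow τ z) x) (Ucl ρ θ u τ x)) z ∂(P N) with hHdef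
  set ℓ : ℕ → ℝ → ℝ := fun N τ => ∫ z, (G' N).indicator
      (fun z => obs σ ρ θ u τ ((Φ N).flow τ z) - ∫ x, Lcl σ ρ θ u τ x (Ucl ρ θ u τ x)) z ∂(P N) with hℓdef
  obtain ⟨N₀, hN₀⟩ := Filter.eventually_atTop.1 hHev
  set H' : ℕ → ℝ → ℝ := fun N τ => if N₀ ≤ N then H N τ else 0 with hH'def
  have hH'eq : ∀ N, N₀ ≤ N → H' N = H N := fun N hN => by
    funext τ; simp [hH'def, hN]
  have hH'0 : ∀ N, ∀ s ∈ Icc 0 t, 0 ≤ H' N s := by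
    intro N s hs
    by_cases hN : N₀ ≤ N
    · rw [hH'eq N hN]; exact (hN₀ N hN).2 s hs
    · simp [hH'def, hN]
  have hH'int : ∀ N, IntegrableOn (H' N) (Icc 0 t) := by
    intro N
    by_cases hN : N₀ ≤ N
    · rw [hH'eq N hN]; exact (hN₀ N hN).1
    · have : H' N = fun _ => 0 := by funext τ; simp [hH'def, hN]
      rw [this]; exact integrableOn_zero
  -- (a) ledger for `H'`
  have hLed' : ∀ δ : ℝ, 0 < δ → ∀ᶠ N in atTop, ∀ s ∈ Icc 0 t, H' N s + ℓ N s ≤ δ := by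
    intro δ hδ
    filter_upwards [hLed δ hδ, eventually_ge_atTop N₀] with N hN hN0 s hs
    rw [hH'eq N hN0]
    exact (hN s hs).2.2
  -- (b) increment bound for `H'`
  have hInc' : ∀ M : ℝ, 1 ≤ M → ∀ᶠ N in atTop, ∀ s ∈ Icc 0 t,
      ℓ N 0 - ℓ N s ≤ K * Real.sqrt M * (∫ τ in Icc 0 s, H' N τ) +
        K * Real.sqrt M * Real.exp (-(lam * M / 4)) + err N := by
    intro M hM
    filter_upwards [hInc M hM, eventually_ge_atTop N₀] with N hN hN0 s hs
    rw [hH'eq N hN0]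
    exact hN s hs
  -- (c) the initial term, rewritten on the good set (`flow 0 = id` there)
  have hℓ0 : Tendsto (fun N => ℓ N 0) atTop (𝓝 0) := by
    refine hInit.congr fun N => ?_
    refine integral_congr_ae (Filter.Eventually.of_forall fun z => ?_)
    by_cases hz : z ∈ G' N
    · simp only [indicator_of_mem hz, (Φ N).flow_zero z (hG'g N hz)]
    · simp only [indicator_of_notMem hz]
  -- Step E: the abstract Gronwall
  have hcore := engine_core t K lam ht hK hlam H' ℓ err hH'0 hH'int hLed' hInc' herr hℓ0 t ⟨ht.le, le_rfl⟩
  have hHt : Tendsto (fun N => H N t) atTop (𝓝 0) := by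
    refine hcore.congr' ?_
    filter_upwards [eventually_ge_atTop N₀] with N hN
    rw [hH'eq N hN]
  -- Step F: the coercive readout, on the eventually-good events
  obtain ⟨N₁, hN₁⟩ := Filter.eventually_atTop.1 (hLed 1 one_pos)
  set G'' : (N : ℕ) → Set (Config (N + 1) (Fin 3) T3) := fun N => if N₁ ≤ N then G' N else ∅ with hG''
  have hG''eq : ∀ N, N₁ ≤ N → G'' N = G' N := fun N hN => by simp [hG'', hN]
  have hG''lt : ∀ N, ¬ N₁ ≤ N → G'' N = ∅ := fun N hN => by simp [hG'', hN]
  have hG''m : ∀ N, MeasurableSet (G'' N) := by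
    intro N; by_cases hN : N₁ ≤ N
    · rw [hG''eq N hN]; exact hG'm N
    · rw [hG''lt N hN]; exact MeasurableSet.empty
  have hG''g : ∀ N, G'' N ⊆ (Φ N).good := by
    intro N; by_cases hN : N₁ ≤ N
    · rw [hG''eq N hN]; exact hG'g N
    · rw [hG''lt N hN]; exact empty_subset _
  have hG''band : ∀ N, ∀ z ∈ G'' N, ∀ x,
      c₁ ≤ bρ (φ N) ((Φ N).flow t z) x ∧ bρ (φ N) ((Φ N).flow t z) x * σ ^ 3 ≤ 1 := by
    intro N z hz x; by_cases hN : N₁ ≤ N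
    · rw [hG''eq N hN] at hz; exact hG'band N z hz t ⟨ht.le, le_rfl⟩ x
    · rw [hG''lt N hN] at hz; exact absurd hz (notMem_empty _)
  have hG''c : Tendsto (fun N => P N (G'' N)ᶜ) atTop (𝓝 0) := by
    refine hG'c.congr' ?_
    filter_upwards [eventually_ge_atTop N₁] with N hN
    rw [hG''eq N hN]
  have hG''i : ∀ N, Integrable (fun z => (G'' N).indicator
      (fun z => ∫ x, relEnt σ (bU (φ N) ((Φ N).flow t z) x) (Ucl ρ θ u t x)) z) (P N) := by
    intro N; by_cases hN : N₁ ≤ N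
    · rw [hG''eq N hN]; exact (hN₁ N hN t ⟨ht.le, le_rfl⟩).1
    · rw [hG''lt N hN]; simp
  have hG''lim : Tendsto (fun N => ∫ z, (G'' N).indicator
      (fun z => ∫ x, relEnt σ (bU (φ N) ((Φ N).flow t z) x) (Ucl ρ θ u t x)) z ∂(P N)) atTop (𝓝 0) := by
    refine hHt.congr' ?_
    filter_upwards [eventually_ge_atTop N₁] with N hN
    rw [hG''eq N hN]
  exact engine_readout σ hσ hσhalf hH a₀ θ₀ u₀ ha hθ hu ha0 hθ0 T ρ θ u hsol η₃ hT hch Φ γ C φ hγ hγ' hφ t htI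
    c₁ hc₁ G'' hG''m hG''g hG''band hG''c hG''i hG''lim

end Barycentric

end Summit.AtomisticToContinuum.HydrodynamicLimit.Theorems.MacroClosureLine

end
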